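import Mathlib
import Literature.Algebra.Polynomial.FischerInnerProduct
import Summits.CriticalPhenomena.Ising3DConformalLimit.Theses.HarmonicMomentsIsotropy
import Summits.CriticalPhenomena.Ising3DConformalLimit.Theorems.HarmonicMomentsIsotropyHarmonicDilution
import Summits.CriticalPhenomena.Ising3DConformalLimit.Theorems.HarmonicMomentsIsotropyHarmonicDilutionReynolds
import Summits.CriticalPhenomena.Ising3DConformalLimit.Theorems.HarmonicMomentsIsotropyDilutionTransferFischer
import HarnessLib

/-!
# Route HarmonicMomentsIsotropy — the rotation form of `HarmonicDilution`

Item `stmt-CriticalPhenomena-6034` (`HarmonicDilution`) asks that for every HARMONIC homogeneous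
`Y` of degree `n ≥ 1` and every `m` the normalised moment
`a_{Y,m}(β) = ∑_x Y(x)|x|^{2m}G_β(x) / ∑_x |x|^{n+2m}G_β(x)` of the subcritical two-point function
`G_β = ⟨σ₀σ_x⟩^∅_β` on `ℤ³` tends to `0` as `β ↑ β_c(3)`.  This file gives the milestone a
harmonic-free form, the one a consumer proving rotation invariance of a limit object wants:

* `harmonicDilution_iff_rotationForm` — `HarmonicDilution` holds iff for EVERY homogeneous
  polynomial `P` (degree `p`, no harmonicity), every `m` and every pair `i, j`, the normalised
  moment of the infinitesimally rotated weight `(L_{ij}P)(x)|x|^{2m}`,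
  `L_{ij} = xᵢ∂ⱼ - xⱼ∂ᵢ ∈ so(3)`, tends to `0`:
  `∑_x (L_{ij}P)(x)|x|^{2m}G_β(x) / ∑_x |x|^{p+2m}G_β(x) → 0` as `β ↑ β_c(3)` — i.e. every limit point
  of the normalised moment functionals `P ↦ ∑_x P(x)G_β(x)/M_{deg P}(β)` is annihilated by `so(3)`.

`⇒` (`rotationForm_of_harmonicDilution`): by the Fischer decomposition `P = ∑_t |x|^{2t}H_t`
(`fischer_decomposition`, Stein–Weiss IV.2.1) and `L_{ij}(|x|^{2t}H) = |x|^{2t}L_{ij}H`,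
`[Δ, L_{ij}] = 0`, the rotated weight is a sum of harmonic weights `(L_{ij}H_t)|x|^{2(t+m)}` of
degrees `p - 2t ≥ 1` (the radial summand `t = p/2` is killed by `L_{ij}`), each governed by the
item.  `⇐` (`harmonicDilution_of_rotationForm`): the Casimir identity
`∑_{i<j} L_{ij}(L_{ij}Y) = -n(n+1)Y` for harmonic homogeneous `Y` of degree `n` exhibits `Y` as a
combination of doubly rotated homogeneous polynomials of the same degree.

The algebra of the angular-momentum operators on `ℝ[X₀,X₁,X₂]` comes first
(`isHomogeneous_angMom`, `laplacian_angMom`, `angMom_rsq_pow_mul`, `angMom_casimir`); the lattice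
side uses only summability of polynomial moments below `β_c` (`summable_polyMoment`).
-/

namespace Summit.CriticalPhenomena.Ising3DConformalLimit.Theorems

open MvPolynomial
open Summit.CriticalPhenomena.Ising3DConformalLimit.Theorems.HarmonicMomentsIsotropy.Fischer
  (rsq pderiv_rsq pderiv_eq_zero_of_isHomogeneous_zero fischer_decomposition lap_apply)
open Literature.Algebra.Polynomial (pderiv_pderiv_comm)

/-! ### Angular-momentum operators on `ℝ[X₀,X₁,X₂]` -/

/-- `L_{ij} P = Xᵢ ∂ⱼP - Xⱼ ∂ᵢP` is homogeneous of the same degree as `P`. -/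
theorem isHomogeneous_angMom {P : MvPolynomial (Fin 3) ℝ} {p : ℕ} (hP : P.IsHomogeneous p)
    (i j : Fin 3) : (X i * pderiv j P - X j * pderiv i P).IsHomogeneous p := by
  rcases Nat.eq_zero_or_pos p with rfl | hp
  · rw [pderiv_eq_zero_of_isHomogeneous_zero hP i, pderiv_eq_zero_of_isHomogeneous_zero hP j,
      mul_zero, mul_zero, sub_zero]
    exact isHomogeneous_zero _ _ _
  · have h1 : ∀ l l' : Fin 3, (X l * pderiv l' P : MvPolynomial (Fin 3) ℝ).IsHomogeneous p := by
      intro l l'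
      have h := (isHomogeneous_X ℝ l).mul (hP.pderiv (i := l'))
      rwa [show 1 + (p - 1) = p by omega] at h
    exact (h1 i j).sub (h1 j i)

/-- `Δ(Xᵢ Q) = 2 ∂ᵢQ + Xᵢ ΔQ`. -/
theorem laplacian_X_mul (i : Fin 3) (Q : MvPolynomial (Fin 3) ℝ) :
    ∑ l : Fin 3, pderiv l (pderiv l (X i * Q)) =
      2 * pderiv i Q + X i * ∑ l : Fin 3, pderiv l (pderiv l Q) := by
  have key : ∀ l : Fin 3, pderiv l (pderiv l (X i * Q)) =
      (if i = l then 2 * pderiv l Q else 0) + X i * pderiv l (pderiv l Q) := by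
    intro l
    by_cases h : i = l
    · subst h
      rw [if_pos rfl, pderiv_mul, pderiv_X_self, one_mul, map_add, pderiv_mul, pderiv_X_self,
        one_mul]
      ring
    · rw [if_neg h, pderiv_mul, pderiv_X_of_ne h, zero_mul, zero_add, pderiv_mul,
        pderiv_X_of_ne h, zero_mul, zero_add]
  simp_rw [key]
  rw [Finset.sum_add_distrib, Finset.sum_ite_eq, if_pos (Finset.mem_univ _), ← Finset.mul_sum]

/-- The Laplacian commutes with `L_{ij}`: `Δ(Xᵢ∂ⱼP - Xⱼ∂ᵢP) = Xᵢ∂ⱼ(ΔP) - Xⱼ∂ᵢ(ΔP)`. -/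
theorem laplacian_angMom (i j : Fin 3) (P : MvPolynomial (Fin 3) ℝ) :
    ∑ l : Fin 3, pderiv l (pderiv l (X i * pderiv j P - X j * pderiv i P)) =
      X i * pderiv j (∑ l : Fin 3, pderiv l (pderiv l P)) -
        X j * pderiv i (∑ l : Fin 3, pderiv l (pderiv l P)) := by
  have hcomm : ∀ a : Fin 3, ∑ l : Fin 3, pderiv l (pderiv l (pderiv a P)) =
      pderiv a (∑ l : Fin 3, pderiv l (pderiv l P)) := by
    intro a
    rw [map_sum]
    refine Finset.sum_congr rfl fun l _ => ?_
    rw [pderiv_pderiv_comm l a P, pderiv_pderiv_comm l a (pderiv l P)]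
  simp only [map_sub, Finset.sum_sub_distrib]
  rw [laplacian_X_mul, laplacian_X_mul, hcomm i, hcomm j, pderiv_pderiv_comm i j P]
  ring

/-- `L_{ij}` preserves harmonicity. -/
theorem laplacian_angMom_eq_zero {P : MvPolynomial (Fin 3) ℝ}
    (hP : ∑ l : Fin 3, pderiv l (pderiv l P) = 0) (i j : Fin 3) :
    ∑ l : Fin 3, pderiv l (pderiv l (X i * pderiv j P - X j * pderiv i P)) = 0 := by
  rw [laplacian_angMom, hP, map_zero, map_zero, mul_zero, mul_zero, sub_zero]

/-- `L_{ij}` is a derivation killing `|x|²`: `L_{ij}(|x|^{2t} H) = |x|^{2t} L_{ij} H`. -/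
theorem angMom_rsq_pow_mul (i j : Fin 3) (t : ℕ) (H : MvPolynomial (Fin 3) ℝ) :
    X i * pderiv j (rsq ^ t * H) - X j * pderiv i (rsq ^ t * H) =
      rsq ^ t * (X i * pderiv j H - X j * pderiv i H) := by
  have hpow : ∀ l : Fin 3, pderiv l (rsq ^ t) = (t : MvPolynomial (Fin 3) ℝ) * rsq ^ (t - 1) *
      (2 * X l) := by
    intro l
    rw [(pderiv l).leibniz_pow rsq t, pderiv_rsq, smul_eq_mul, nsmul_eq_mul]
    ring
  rw [pderiv_mul, pderiv_mul, hpow, hpow]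
  ring

/-- One angular-momentum operator squared, expanded (for `i ≠ j`):
`L_{ij}(L_{ij}Y) = Xᵢ²∂ⱼ∂ⱼY + Xⱼ²∂ᵢ∂ᵢY - 2XᵢXⱼ∂ᵢ∂ⱼY - Xᵢ∂ᵢY - Xⱼ∂ⱼY`. -/
theorem angMom_angMom {i j : Fin 3} (hij : i ≠ j) (Y : MvPolynomial (Fin 3) ℝ) :
    X i * pderiv j (X i * pderiv j Y - X j * pderiv i Y) -
        X j * pderiv i (X i * pderiv j Y - X j * pderiv i Y) =
      X i ^ 2 * pderiv j (pderiv j Y) + X j ^ 2 * pderiv i (pderiv i Y) -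
        2 * (X i * X j * pderiv i (pderiv j Y)) - X i * pderiv i Y - X j * pderiv j Y := by
  simp only [map_sub, pderiv_mul, pderiv_X_self, pderiv_X_of_ne hij, pderiv_X_of_ne hij.symm]
  rw [pderiv_pderiv_comm j i Y]
  ring

/-- **Casimir identity.**  For a harmonic homogeneous `Y` of degree `n` on `ℝ³`,
`L₀₁(L₀₁Y) + L₀₂(L₀₂Y) + L₁₂(L₁₂Y) = -n(n+1)·Y` (`L_{ij} = Xᵢ∂ⱼ - Xⱼ∂ᵢ`): the harmonic homogeneous
polynomials of degree `n` are eigenvectors of `∑ L_{ij}²` (in general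
`∑_{i<j} L_{ij}² = |x|²Δ - E(E+1)` with `E = ∑ Xᵢ∂ᵢ` the Euler operator). -/
theorem angMom_casimir {Y : MvPolynomial (Fin 3) ℝ} {n : ℕ} (hY : Y.IsHomogeneous n)
    (hΔ : ∑ l : Fin 3, pderiv l (pderiv l Y) = 0) :
    (X 0 * pderiv 1 (X 0 * pderiv 1 Y - X 1 * pderiv 0 Y) -
        X 1 * pderiv 0 (X 0 * pderiv 1 Y - X 1 * pderiv 0 Y)) +
      (X 0 * pderiv 2 (X 0 * pderiv 2 Y - X 2 * pderiv 0 Y) -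
        X 2 * pderiv 0 (X 0 * pderiv 2 Y - X 2 * pderiv 0 Y)) +
      (X 1 * pderiv 2 (X 1 * pderiv 2 Y - X 2 * pderiv 1 Y) -
        X 2 * pderiv 1 (X 1 * pderiv 2 Y - X 2 * pderiv 1 Y)) =
      -(((n : MvPolynomial (Fin 3) ℝ) * ((n : MvPolynomial (Fin 3) ℝ) + 1)) * Y) := by
  rw [angMom_angMom (by decide : (0 : Fin 3) ≠ 1), angMom_angMom (by decide : (0 : Fin 3) ≠ 2),
    angMom_angMom (by decide : (1 : Fin 3) ≠ 2)]
  -- Euler for `Y` and for its first derivatives, and the Laplacian, in three coordinates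
  have hE : X 0 * pderiv 0 Y + X 1 * pderiv 1 Y + X 2 * pderiv 2 Y =
      (n : MvPolynomial (Fin 3) ℝ) * Y := by
    have h := hY.sum_X_mul_pderiv
    rw [Fin.sum_univ_three, nsmul_eq_mul] at h
    exact h
  have hEl : ∀ l : Fin 3, X 0 * pderiv 0 (pderiv l Y) + X 1 * pderiv 1 (pderiv l Y) +
      X 2 * pderiv 2 (pderiv l Y) = ((n : MvPolynomial (Fin 3) ℝ) - 1) * pderiv l Y := by
    intro l
    rcases Nat.eq_zero_or_pos n with rfl | hn
    · rw [pderiv_eq_zero_of_isHomogeneous_zero hY l]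
      simp
    · have h := (hY.pderiv (i := l)).sum_X_mul_pderiv
      rw [Fin.sum_univ_three, nsmul_eq_mul, Nat.cast_sub hn, Nat.cast_one] at h
      exact h
  have hΔ' : pderiv 0 (pderiv 0 Y) + pderiv 1 (pderiv 1 Y) + pderiv 2 (pderiv 2 Y) = 0 := by
    rw [Fin.sum_univ_three] at hΔ
    exact hΔ
  have hE0 := hEl 0
  have hE1 := hEl 1
  have hE2 := hEl 2
  rw [pderiv_pderiv_comm 1 0 Y] at hE0
  rw [pderiv_pderiv_comm 2 0 Y] at hE0
  rw [pderiv_pderiv_comm 2 1 Y] at hE1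
  linear_combination (X 0 ^ 2 + X 1 ^ 2 + X 2 ^ 2) * hΔ' - X 0 * hE0 - X 1 * hE1 - X 2 * hE2 -
    ((n : MvPolynomial (Fin 3) ℝ) + 1) * hE


/-! ### Lattice moments of Fischer summands -/

section Lattice

open Filter Topology Set
open Literature.Probability.LatticeModels
open Summit.CriticalPhenomena.Ising3DConformalLimit.Theses.HarmonicMomentsIsotropy

/-- `(|x|^{2t} Q)(x) = |x|^{2t} Q(x)` at a lattice point, `|x| = √(∑ xᵢ²)`. -/
theorem eval_rsq_pow_mul (t : ℕ) (Q : MvPolynomial (Fin 3) ℝ) (x : Site 3) :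
    MvPolynomial.eval (fun l => ((x l : ℤ) : ℝ)) (rsq ^ t * Q) =
      Real.sqrt (∑ l, ((x l : ℤ) : ℝ) ^ 2) ^ (2 * t) *
        MvPolynomial.eval (fun l => ((x l : ℤ) : ℝ)) Q := by
  have hr : MvPolynomial.eval (fun l => ((x l : ℤ) : ℝ)) rsq = ∑ l, ((x l : ℤ) : ℝ) ^ 2 := by
    simp [rsq, map_sum]
  rw [map_mul, map_pow, hr, pow_mul, Real.sq_sqrt (Finset.sum_nonneg fun l _ => sq_nonneg _)]

/-- The weight `(|x|^{2t}Q)(x)|x|^{2m}G` is the weight `Q(x)|x|^{2(t+m)}G`. -/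
theorem summand_rsq_pow_mul (t m : ℕ) (Q : MvPolynomial (Fin 3) ℝ) (β : ℝ) (x : Site 3) :
    MvPolynomial.eval (fun l => ((x l : ℤ) : ℝ)) (rsq ^ t * Q) *
        Real.sqrt (∑ l, ((x l : ℤ) : ℝ) ^ 2) ^ (2 * m) * twoPointFree 3 β x =
      MvPolynomial.eval (fun l => ((x l : ℤ) : ℝ)) Q *
        Real.sqrt (∑ l, ((x l : ℤ) : ℝ) ^ 2) ^ (2 * (t + m)) * twoPointFree 3 β x := by
  rw [eval_rsq_pow_mul, show 2 * (t + m) = 2 * t + 2 * m by ring, pow_add]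
  ring

/-! ### `HarmonicDilution` ⇒ the rotation form -/

/-- **Rotation form from the item.**  `HarmonicDilution` implies: for every homogeneous `P` of
degree `p`, every `m` and all `i, j`,
`∑_x (Xᵢ∂ⱼP - Xⱼ∂ᵢP)(x)|x|^{2m}G_β(x) / ∑_x |x|^{p+2m}G_β(x) → 0` as `β ↑ β_c(3)` (Fischer
decomposition of `P`; `L_{ij}` acts summand-wise and preserves harmonicity). -/
theorem rotationForm_of_harmonicDilution (h : HarmonicDilution) :
    ∀ (p m : ℕ) (P : MvPolynomial (Fin 3) ℝ) (i j : Fin 3), P.IsHomogeneous p →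
      Tendsto (fun β => (∑' x : Site 3, MvPolynomial.eval (fun l => ((x l : ℤ) : ℝ))
            (MvPolynomial.X i * MvPolynomial.pderiv j P - MvPolynomial.X j * MvPolynomial.pderiv i P) *
            Real.sqrt (∑ l, ((x l : ℤ) : ℝ) ^ 2) ^ (2 * m) * twoPointFree 3 β x) /
          (∑' x : Site 3, Real.sqrt (∑ l, ((x l : ℤ) : ℝ) ^ 2) ^ (p + 2 * m) * twoPointFree 3 β x))
        (𝓝[<] criticalBeta 3) (𝓝 0) := by
  dsimp only [HarmonicDilution] at h
  intro p m P i j hP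
  have hβc : 0 < criticalBeta 3 := criticalBeta_pos_holds (by norm_num)
  obtain ⟨H, hHhom, hHlap, hPeq⟩ := fischer_decomposition p P hP
  -- `L P = ∑_t |x|^{2t} L H_t`
  have hL : X i * pderiv j P - X j * pderiv i P =
      ∑ t ∈ Finset.range (p / 2 + 1), rsq ^ t * (X i * pderiv j (H t) - X j * pderiv i (H t)) := by
    conv_lhs => rw [hPeq]
    rw [map_sum, map_sum, Finset.mul_sum, Finset.mul_sum, ← Finset.sum_sub_distrib]
    exact Finset.sum_congr rfl fun t _ => angMom_rsq_pow_mul i j t (H t)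
  have hLhom : ∀ t, (X i * pderiv j (H t) - X j * pderiv i (H t)).IsHomogeneous (p - 2 * t) :=
    fun t => isHomogeneous_angMom (hHhom t) i j
  have hLlap : ∀ t, ∑ l : Fin 3, pderiv l (pderiv l (X i * pderiv j (H t) - X j * pderiv i (H t)))
      = 0 := fun t => laplacian_angMom_eq_zero (by rw [← lap_apply]; exact hHlap t) i j
  -- the rotated moment is the sum of the harmonic moments of the summands, on `[0, β_c)`
  have hk : ∀ β : ℝ, 0 ≤ β → β < criticalBeta 3 →
      (∑' x : Site 3, MvPolynomial.eval (fun l => ((x l : ℤ) : ℝ))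
          (X i * pderiv j P - X j * pderiv i P) *
          Real.sqrt (∑ l, ((x l : ℤ) : ℝ) ^ 2) ^ (2 * m) * twoPointFree 3 β x) =
        ∑ t ∈ Finset.range (p / 2 + 1), (∑' x : Site 3, MvPolynomial.eval (fun l => ((x l : ℤ) : ℝ))
          (X i * pderiv j (H t) - X j * pderiv i (H t)) *
          Real.sqrt (∑ l, ((x l : ℤ) : ℝ) ^ 2) ^ (2 * (t + m)) * twoPointFree 3 β x) := by
    intro β hβ0 hβ
    rw [← Summable.tsum_finsetSum (fun t _ => summable_polyMoment hβ0 hβ _ (hLhom t) (t + m))]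
    refine tsum_congr fun x => ?_
    rw [hL, map_sum, Finset.sum_mul, Finset.sum_mul]
    exact Finset.sum_congr rfl fun t _ => summand_rsq_pow_mul t m _ β x
  -- each normalised summand tends to `0`
  have hterm : ∀ t ∈ Finset.range (p / 2 + 1), Tendsto (fun β =>
      (∑' x : Site 3, MvPolynomial.eval (fun l => ((x l : ℤ) : ℝ))
          (X i * pderiv j (H t) - X j * pderiv i (H t)) *
          Real.sqrt (∑ l, ((x l : ℤ) : ℝ) ^ 2) ^ (2 * (t + m)) * twoPointFree 3 β x) /
        (∑' x : Site 3, Real.sqrt (∑ l, ((x l : ℤ) : ℝ) ^ 2) ^ (p + 2 * m) * twoPointFree 3 β x))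
      (𝓝[<] criticalBeta 3) (𝓝 0) := by
    intro t ht
    have ht' : 2 * t ≤ p := by
      rw [Finset.mem_range] at ht
      omega
    rcases Nat.eq_zero_or_pos (p - 2 * t) with h0 | hpos
    · -- the radial summand: `H_t` is a constant, `L H_t = 0`
      have hH0 : (H t).IsHomogeneous 0 := h0 ▸ hHhom t
      have hz : X i * pderiv j (H t) - X j * pderiv i (H t) = 0 := by
        rw [pderiv_eq_zero_of_isHomogeneous_zero hH0 i, pderiv_eq_zero_of_isHomogeneous_zero hH0 j,
          mul_zero, mul_zero, sub_zero]
      simp only [hz, map_zero, zero_mul, tsum_zero, zero_div]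
      exact tendsto_const_nhds
    · have hlim := h (p - 2 * t) (t + m) _ hpos (hLhom t) (hLlap t)
      have e : p - 2 * t + 2 * (t + m) = p + 2 * m := by omega
      simpa only [e] using hlim
  have hsum := tendsto_finsetSum (Finset.range (p / 2 + 1)) hterm
  simp only [Finset.sum_const_zero] at hsum
  refine hsum.congr' ?_
  filter_upwards [Ioo_mem_nhdsLT hβc] with β hβ
  rw [hk β hβ.1.le hβ.2, Finset.sum_div]

/-! ### The rotation form ⇒ `HarmonicDilution` -/

/-- **The item from the rotation form.**  If every normalised rotated moment tends to `0`, then so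
does every normalised harmonic moment: a harmonic homogeneous `Y` of degree `n ≥ 1` is
`-(1/(n(n+1))) ∑_{i<j} L_{ij}(L_{ij}Y)` (Casimir), a combination of rotated homogeneous polynomials
of degree `n`. -/
theorem harmonicDilution_of_rotationForm
    (h :
      ∀ (p m : ℕ) (P : MvPolynomial (Fin 3) ℝ) (i j : Fin 3), P.IsHomogeneous p →
        Tendsto (fun β => (∑' x : Site 3, MvPolynomial.eval (fun l => ((x l : ℤ) : ℝ))
              (MvPolynomial.X i * MvPolynomial.pderiv j P - MvPolynomial.X j * MvPolynomial.pderiv i P) *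
              Real.sqrt (∑ l, ((x l : ℤ) : ℝ) ^ 2) ^ (2 * m) * twoPointFree 3 β x) /
            (∑' x : Site 3, Real.sqrt (∑ l, ((x l : ℤ) : ℝ) ^ 2) ^ (p + 2 * m) * twoPointFree 3 β x))
          (𝓝[<] criticalBeta 3) (𝓝 0)) :
    HarmonicDilution := by
  dsimp only [HarmonicDilution]
  intro n m Y hn hY hΔ
  have hβc : 0 < criticalBeta 3 := criticalBeta_pos_holds (by norm_num)
  have hC := angMom_casimir hY hΔ
  have h01 := h n m (X 0 * pderiv 1 Y - X 1 * pderiv 0 Y) 0 1 (isHomogeneous_angMom hY 0 1)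
  have h02 := h n m (X 0 * pderiv 2 Y - X 2 * pderiv 0 Y) 0 2 (isHomogeneous_angMom hY 0 2)
  have h12 := h n m (X 1 * pderiv 2 Y - X 2 * pderiv 1 Y) 1 2 (isHomogeneous_angMom hY 1 2)
  have hlim := ((h01.add h02).add h12).const_mul (-(1 / ((n : ℝ) * (n + 1))))
  rw [add_zero, add_zero, mul_zero] at hlim
  refine hlim.congr' ?_
  filter_upwards [Ioo_mem_nhdsLT hβc] with β hβ
  -- the three doubly rotated moments are summable and add up to `-n(n+1) k_{Y,m}`
  have hs01 := summable_polyMoment hβ.1.le hβ.2 _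
    (isHomogeneous_angMom (isHomogeneous_angMom hY 0 1) 0 1) m
  have hs02 := summable_polyMoment hβ.1.le hβ.2 _
    (isHomogeneous_angMom (isHomogeneous_angMom hY 0 2) 0 2) m
  have hs12 := summable_polyMoment hβ.1.le hβ.2 _
    (isHomogeneous_angMom (isHomogeneous_angMom hY 1 2) 1 2) m
  have hkY : ((n : ℝ) * (n + 1)) *
      (∑' x : Site 3, MvPolynomial.eval (fun i => ((x i : ℤ) : ℝ)) Y *
        Real.sqrt (∑ i, ((x i : ℤ) : ℝ) ^ 2) ^ (2 * m) * twoPointFree 3 β x) =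
      -((∑' x : Site 3, MvPolynomial.eval (fun l => ((x l : ℤ) : ℝ))
          (X 0 * pderiv 1 (X 0 * pderiv 1 Y - X 1 * pderiv 0 Y) -
            X 1 * pderiv 0 (X 0 * pderiv 1 Y - X 1 * pderiv 0 Y)) *
          Real.sqrt (∑ l, ((x l : ℤ) : ℝ) ^ 2) ^ (2 * m) * twoPointFree 3 β x) +
        (∑' x : Site 3, MvPolynomial.eval (fun l => ((x l : ℤ) : ℝ))
          (X 0 * pderiv 2 (X 0 * pderiv 2 Y - X 2 * pderiv 0 Y) -
            X 2 * pderiv 0 (X 0 * pderiv 2 Y - X 2 * pderiv 0 Y)) *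
          Real.sqrt (∑ l, ((x l : ℤ) : ℝ) ^ 2) ^ (2 * m) * twoPointFree 3 β x) +
        (∑' x : Site 3, MvPolynomial.eval (fun l => ((x l : ℤ) : ℝ))
          (X 1 * pderiv 2 (X 1 * pderiv 2 Y - X 2 * pderiv 1 Y) -
            X 2 * pderiv 1 (X 1 * pderiv 2 Y - X 2 * pderiv 1 Y)) *
          Real.sqrt (∑ l, ((x l : ℤ) : ℝ) ^ 2) ^ (2 * m) * twoPointFree 3 β x)) := by
    rw [← hs01.tsum_add hs02, ← (hs01.add hs02).tsum_add hs12, ← tsum_neg, ← tsum_mul_left]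
    refine tsum_congr fun x => ?_
    have hx := congrArg (MvPolynomial.eval (fun l => ((x l : ℤ) : ℝ))) hC
    simp only [map_add, map_neg, map_mul, map_natCast, map_one] at hx
    linear_combination (Real.sqrt (∑ l, ((x l : ℤ) : ℝ) ^ 2) ^ (2 * m) * twoPointFree 3 β x) * hx
  have hn0 : ((n : ℝ) * (n + 1)) ≠ 0 := by positivity
  have hkY' : (∑' x : Site 3, MvPolynomial.eval (fun i => ((x i : ℤ) : ℝ)) Y *
        Real.sqrt (∑ i, ((x i : ℤ) : ℝ) ^ 2) ^ (2 * m) * twoPointFree 3 β x) =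
      -(1 / ((n : ℝ) * (n + 1))) *
        ((∑' x : Site 3, MvPolynomial.eval (fun l => ((x l : ℤ) : ℝ))
          (X 0 * pderiv 1 (X 0 * pderiv 1 Y - X 1 * pderiv 0 Y) -
            X 1 * pderiv 0 (X 0 * pderiv 1 Y - X 1 * pderiv 0 Y)) *
          Real.sqrt (∑ l, ((x l : ℤ) : ℝ) ^ 2) ^ (2 * m) * twoPointFree 3 β x) +
        (∑' x : Site 3, MvPolynomial.eval (fun l => ((x l : ℤ) : ℝ))
          (X 0 * pderiv 2 (X 0 * pderiv 2 Y - X 2 * pderiv 0 Y) -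
            X 2 * pderiv 0 (X 0 * pderiv 2 Y - X 2 * pderiv 0 Y)) *
          Real.sqrt (∑ l, ((x l : ℤ) : ℝ) ^ 2) ^ (2 * m) * twoPointFree 3 β x) +
        (∑' x : Site 3, MvPolynomial.eval (fun l => ((x l : ℤ) : ℝ))
          (X 1 * pderiv 2 (X 1 * pderiv 2 Y - X 2 * pderiv 1 Y) -
            X 2 * pderiv 1 (X 1 * pderiv 2 Y - X 2 * pderiv 1 Y)) *
          Real.sqrt (∑ l, ((x l : ℤ) : ℝ) ^ 2) ^ (2 * m) * twoPointFree 3 β x)) := by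
    field_simp
    linarith [hkY]
  rw [hkY']
  ring

/-- **The rotation form of the milestone.**  `HarmonicDilution` (item stmt-CriticalPhenomena-6034)
is equivalent to the asymptotic annihilation of the normalised subcritical moment functionals by
the infinitesimal rotations: for every homogeneous `P` of degree `p`, every `m ≥ 0` and all
`i, j ∈ {0,1,2}`,
`∑_x (xᵢ∂ⱼP - xⱼ∂ᵢP)(x) |x|^{2m} ⟨σ₀σ_x⟩^∅_β / ∑_x |x|^{p+2m} ⟨σ₀σ_x⟩^∅_β → 0` as `β ↑ β_c(3)`. -/
theorem harmonicDilution_iff_rotationForm :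
    HarmonicDilution ↔
      ∀ (p m : ℕ) (P : MvPolynomial (Fin 3) ℝ) (i j : Fin 3), P.IsHomogeneous p →
        Tendsto (fun β => (∑' x : Site 3, MvPolynomial.eval (fun l => ((x l : ℤ) : ℝ))
              (MvPolynomial.X i * MvPolynomial.pderiv j P - MvPolynomial.X j * MvPolynomial.pderiv i P) *
              Real.sqrt (∑ l, ((x l : ℤ) : ℝ) ^ 2) ^ (2 * m) * twoPointFree 3 β x) /
            (∑' x : Site 3, Real.sqrt (∑ l, ((x l : ℤ) : ℝ) ^ 2) ^ (p + 2 * m) * twoPointFree 3 β x))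
          (𝓝[<] criticalBeta 3) (𝓝 0) :=
  ⟨rotationForm_of_harmonicDilution, harmonicDilution_of_rotationForm⟩

end Lattice

end Summit.CriticalPhenomena.Ising3DConformalLimit.Theorems
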